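import Literature.NumberTheory.GaloisRepresentations.AbsolutelyIrreducibleReductionBridge
import Literature.NumberTheory.GaloisRepresentations.FramedRepTwist
import Literature.NumberTheory.Automorphic.LanglandsTetrahedral
import HarnessLib

/-!
# Two elementary permanence properties of absolute irreducibility

Topic `NumberTheory/GaloisRepresentations`; namespace `Literature.NumberTheory.GaloisRepresentations`.
Everything here is **proved** (no named fact), in the vocabulary of `ContinuousRep.lean`
(`FramedRep.IsAbsolutelyIrreducible`), `FramedRepTwist.lean` (`FramedRep.twist`),
`AbsolutelyIrreducibleReduction(Bridge).lean` (`FramedRep.HasAbsolutelyIrreducibleReduction`,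
`FramedGaloisRep.IsResiduallyAbsIrreducible`) and `GaloisRep.lean` (`FramedGaloisRep.restrictField`).

* `Representation.isIrreducible_comp_of_index_two` — **an irreducible representation of odd
  dimension stays irreducible on every subgroup of index `2`** (over any field): if `U` were a
  proper `N`-stable subspace and `g ∉ N`, then `U + gU` and `U ∩ gU` are `G`-stable, hence `V` and
  `0`, so `V = U ⊕ gU` has even dimension.  (The dimension-parity case of Clifford's theorem,
  Clifford 1937 Thm. 1 / Curtis–Reiner (49.2), which needs neither semisimplicity nor an
  algebraically closed field.)  Framed forms: `FramedRep.IsAbsolutelyIrreducible.comp_of_index_two`,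
  and for Galois representations `FramedGaloisRep.IsAbsolutelyIrreducible.restrictField_of_finrank_eq_two`
  (restriction to `Γ_L` for a quadratic extension `L/K`, index `[L:K] = 2` by
  `Automorphic.isOpen_range_absGaloisRestrict_and_index`).
* (`FramedGaloisRep.restrictField_twist`: restriction to `Γ_L` commutes with twisting, `rfl`; that
  twisting preserves absolute irreducibility is the tree's `FramedRep.isAbsolutelyIrreducible_twist_iff`,
  `Automorphic/BCDTTheoremBNormalisedAssembly`.)
* `FramedRep.HasAbsolutelyIrreducibleReduction.isAbsolutelyIrreducible` — **absolutely irreducible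
  reduction implies absolutely irreducible** for `ρ : Γ → GL_n(K)` over a normed field, `n ≥ 1`: the
  `n²` integral matrices `g ρ(s_a) g⁻¹` of the Burnside form have an entry matrix of unit, hence
  nonzero, determinant, so they already span `M_n(K)` (`FramedRep.isUnit_of_entries_iff_span_eq_top`),
  and spanning `M_n` is absolute irreducibility (Burnside, `span_eq_top_iff_forall_isIrreducible`).
  For `ℚ̄_p`-coefficients: `FramedGaloisRep.IsResiduallyAbsIrreducible.isAbsolutelyIrreducible`
  (Darmon–Diamond–Taylor, *Fermat's Last Theorem*, §2.1: "if `ρ̄` is absolutely irreducible then so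
  is `ρ`").

## References

* A. H. Clifford, *Representations induced in an invariant subgroup*, Ann. of Math. 38 (1937),
  Thm. 1. [Clifford1937]
* C. W. Curtis, I. Reiner, *Representation Theory of Finite Groups and Associative Algebras* (1962),
  (27.4), (49.2). [CurtisReiner1962]
* H. Darmon, F. Diamond, R. Taylor, *Fermat's Last Theorem* (1995), §2.1. [DarmonDiamondTaylor1995]
-/

noncomputable section

open scoped MatrixGroups

namespace Literature.NumberTheory.GaloisRepresentations

universe u v

/-! ### Odd-dimensional irreducible representations restricted to a subgroup of index `2` -/

/-- **Odd dimension, index two.**  Let `π` be an irreducible representation of `G` on a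
finite-dimensional space `V` of odd dimension over a field `k`, and `φ : H → G` a homomorphism whose
image `N` has index `2`.  Then `π ∘ φ` is irreducible.  Proof: for an `N`-stable subspace `U` and
`g ∉ N`, `U + π(g)U` and `U ∩ π(g)U` are `G`-stable (`N` is normal, `g² ∈ N`, `G = N ∪ gN`), so if
`U ≠ 0, V` they are `V` and `0` and `dim V = 2 dim U` is even.  (Parity case of Clifford's theorem.)
[cite: Clifford1937, Thm. 1] -/
theorem Representation.isIrreducible_comp_of_index_two {k : Type u} [Field k] {G H : Type*} [Group G]
    [Group H] {V : Type*} [AddCommGroup V] [Module k V] [FiniteDimensional k V]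
    (π : _root_.Representation k G V) (hπ : π.IsIrreducible) (φ : H →* G) (hφ : φ.range.index = 2)
    (hodd : Odd (Module.finrank k V)) : _root_.Representation.IsIrreducible (π.comp φ) := by
  classical
  haveI := hπ
  set N : Subgroup G := φ.range with hNdef
  haveI hN : N.Normal := Subgroup.normal_of_index_eq_two hφ
  -- an element outside `N`
  obtain ⟨g, hg⟩ : ∃ g : G, g ∉ N := by
    by_contra! h
    have htop : N = ⊤ := eq_top_iff.mpr fun x _ => h x
    rw [htop, Subgroup.index_top] at hφ
    exact absurd hφ (by norm_num)
  have hmul : ∀ {a b : G}, a ∉ N → b ∉ N → a * b ∈ N := fun ha hb =>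
    (Subgroup.mul_mem_iff_of_index_two hφ).mpr (iff_of_false ha hb)
  have hginv : g⁻¹ ∉ N := fun h => hg (by simpa using N.inv_mem h)
  have hcomp : ∀ (a b : G) (v : V), π a (π b v) = π (a * b) v := fun a b v => by
    rw [map_mul]; rfl
  -- `V ≠ 0`
  have hVbt : (⊥ : Submodule k V) ≠ ⊤ := fun h' =>
    (bot_ne_top : (⊥ : Subrepresentation π) ≠ ⊤) (Subrepresentation.toSubmodule_injective h')
  haveI : Nontrivial (Subrepresentation (π.comp φ)) :=
    ⟨⟨⊥, ⊤, fun h => hVbt (congrArg Subrepresentation.toSubmodule h)⟩⟩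
  refine ⟨fun W => ?_⟩
  by_contra hW
  obtain ⟨hWb, hWt⟩ := not_or.mp hW
  set U : Submodule k V := W.toSubmodule with hUdef
  have hUb : U ≠ ⊥ := fun h => hWb (Subrepresentation.toSubmodule_injective h)
  have hUt : U ≠ ⊤ := fun h => hWt (Subrepresentation.toSubmodule_injective h)
  -- `U` is `N`-stable, `U' = π(g) U`
  have hNU : ∀ x ∈ N, ∀ v ∈ U, π x v ∈ U := by
    rintro _ ⟨h, rfl⟩ v hv
    exact W.apply_mem_toSubmodule h hv
  set U' : Submodule k V := U.map (π g) with hU'def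
  have hNU' : ∀ x ∈ N, ∀ v ∈ U', π x v ∈ U' := by
    intro x hx v hv
    obtain ⟨u, hu, rfl⟩ := Submodule.mem_map.mp hv
    rw [hcomp, show x * g = g * (g⁻¹ * x * g) by group, ← hcomp]
    exact Submodule.mem_map_of_mem (hNU _ (by simpa using hN.conj_mem x hx g⁻¹) u hu)
  have hU_of_not : ∀ x ∉ N, ∀ v ∈ U, π x v ∈ U' := by
    intro x hx v hv
    rw [show x = g * (g⁻¹ * x) by group, ← hcomp]
    exact Submodule.mem_map_of_mem (hNU _ (hmul hginv hx) v hv)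
  have hU'_of_not : ∀ x ∉ N, ∀ v ∈ U', π x v ∈ U := by
    intro x hx v hv
    obtain ⟨u, hu, rfl⟩ := Submodule.mem_map.mp hv
    rw [hcomp]
    exact hNU _ (hmul hx hg) u hu
  -- the two `G`-stable subspaces `U + U'` and `U ∩ U'`
  let S₁ : Subrepresentation π := ⟨U ⊔ U', fun x v hv => by
    obtain ⟨a, ha, b, hb, rfl⟩ := Submodule.mem_sup.mp hv
    rw [map_add]
    by_cases hx : x ∈ N
    · exact Submodule.add_mem _ (Submodule.mem_sup_left (hNU x hx a ha))
        (Submodule.mem_sup_right (hNU' x hx b hb))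
    · exact Submodule.add_mem _ (Submodule.mem_sup_right (hU_of_not x hx a ha))
        (Submodule.mem_sup_left (hU'_of_not x hx b hb))⟩
  let S₂ : Subrepresentation π := ⟨U ⊓ U', fun x v hv => by
    obtain ⟨hvU, hvU'⟩ := Submodule.mem_inf.mp hv
    by_cases hx : x ∈ N
    · exact Submodule.mem_inf.mpr ⟨hNU x hx v hvU, hNU' x hx v hvU'⟩
    · exact Submodule.mem_inf.mpr ⟨hU'_of_not x hx v hvU', hU_of_not x hx v hvU⟩⟩
  have h₁ : U ⊔ U' = ⊤ := by
    rcases IsSimpleOrder.eq_bot_or_eq_top S₁ with h | h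
    · exfalso
      have : U ⊔ U' = ⊥ := congrArg Subrepresentation.toSubmodule h
      exact hUb (le_bot_iff.mp (le_sup_left.trans this.le))
    · exact congrArg Subrepresentation.toSubmodule h
  have h₂ : U ⊓ U' = ⊥ := by
    rcases IsSimpleOrder.eq_bot_or_eq_top S₂ with h | h
    · exact congrArg Subrepresentation.toSubmodule h
    · exfalso
      have : U ⊓ U' = ⊤ := congrArg Subrepresentation.toSubmodule h
      exact hUt (top_le_iff.mp (this.ge.trans inf_le_left))
  -- dimension count: `dim V = 2 dim U`
  have hdim := Submodule.finrank_sup_add_finrank_inf_eq U U'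
  rw [h₁, h₂, finrank_top, finrank_bot, add_zero] at hdim
  have hinj : Function.Injective (π g) := by
    intro a b hab
    have := congrArg (π g⁻¹) hab
    rwa [hcomp, hcomp, inv_mul_cancel, map_one, Module.End.one_apply, Module.End.one_apply] at this
  rw [← (Submodule.equivMapOfInjective (π g) hinj U).finrank_eq] at hdim
  exact (Nat.not_even_iff_odd.mpr hodd) ⟨_, hdim⟩

/-! ### Framed representations -/

namespace FramedRep

variable {G : Type*} [Group G] [TopologicalSpace G] {H : Type*} [Group H] [TopologicalSpace H]
  {A : Type v} [Field A] [TopologicalSpace A] {n : ℕ}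

/-- The base change of a pull-back is the pull-back of the base change. [folklore] -/
theorem baseChangeRepresentation_comp {B : Type*} [CommRing B] (f : A →+* B) (ρ : FramedRep G A n)
    (φ : H →ₜ* G) :
    baseChangeRepresentation f (ρ.comp φ) = (ρ.baseChangeRepresentation f).comp φ.toMonoidHom := rfl

/-- **An absolutely irreducible framed representation of odd rank stays absolutely irreducible on
every subgroup of index `2`** (pull-back along `φ : H →ₜ* G` with `[G : φ(H)] = 2`).
[cite: Clifford1937, Thm. 1] -/
theorem IsAbsolutelyIrreducible.comp_of_index_two (hn : Odd n) {ρ : FramedRep G A n}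
    (h : ρ.IsAbsolutelyIrreducible) (φ : H →ₜ* G) (hφ : φ.toMonoidHom.range.index = 2) :
    IsAbsolutelyIrreducible (ρ.comp φ) := by
  intro B _ f
  rw [baseChangeRepresentation_comp]
  exact Representation.isIrreducible_comp_of_index_two _ (h B f) _ hφ (by rwa [Module.finrank_fin_fun])

/-- **Absolutely irreducible reduction implies absolutely irreducible** (`n ≥ 1`): in the frame `g` of
the Burnside form the `n²` matrices `g ρ(s_a) g⁻¹` have an entry matrix of norm-one — hence
nonzero — determinant, so they span `M_n(K)`, and a representation whose image spans `M_n` is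
absolutely irreducible (Burnside).  Ref: Darmon–Diamond–Taylor, *Fermat's Last Theorem* (1995),
§2.1; Curtis–Reiner (27.4). [cite: DarmonDiamondTaylor1995, §2.1] -/
theorem HasAbsolutelyIrreducibleReduction.isAbsolutelyIrreducible {Γ : Type*} [Group Γ]
    [TopologicalSpace Γ] {K : Type v} [NormedField K] {n : ℕ} (hn : 0 < n) {ρ : FramedRep Γ K n}
    (h : ρ.HasAbsolutelyIrreducibleReduction) : ρ.IsAbsolutelyIrreducible := by
  obtain ⟨g, s, -, hdet⟩ := h
  -- the entry matrix is invertible, so the `n²` conjugated matrices span `M_n(K)`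
  have hU : IsUnit (Matrix.of fun a b : Fin n × Fin n =>
      ((g * ρ (s a) * g⁻¹ : GL (Fin n) K) : Matrix (Fin n) (Fin n) K) b.1 b.2) := by
    rw [Matrix.isUnit_iff_isUnit_det, isUnit_iff_ne_zero]
    intro h0
    rw [h0, norm_zero] at hdet
    exact zero_ne_one hdet
  rw [isUnit_of_entries_iff_span_eq_top] at hU
  have hspan : Submodule.span K (Set.range fun σ : Γ =>
      ((g⁻¹⁻¹ : GL (Fin n) K) : Matrix (Fin n) (Fin n) K) * ((ρ σ : GL (Fin n) K) : Matrix (Fin n) (Fin n) K) *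
        ((g⁻¹ : GL (Fin n) K) : Matrix (Fin n) (Fin n) K)) = ⊤ := by
    refine eq_top_iff.2 (hU ▸ Submodule.span_mono ?_)
    rintro _ ⟨a, rfl⟩
    refine ⟨s a, ?_⟩
    simp only [inv_inv, Units.val_mul]
  rw [span_range_units_conj_eq_top_iff] at hspan
  exact (Literature.RepresentationTheory.Semisimple.span_eq_top_iff_forall_isIrreducible hn
    (ρ : Γ →* GL (Fin n) K)).1 hspan

end FramedRep

/-! ### Galois representations -/

namespace FramedGaloisRep

/-- Restriction to `Γ_L` commutes with twisting: `(ρ ⊗ χ)|_{Γ_L} = ρ|_{Γ_L} ⊗ χ|_{Γ_L}`. [folklore] -/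
theorem restrictField_twist {K : Type*} [Field K] {A : Type v} [CommRing A] [TopologicalSpace A]
    [IsTopologicalRing A] {n : ℕ} (L : Type*) [Field L] [Algebra K L] (ρ : FramedGaloisRep K A n)
    (χ : Field.absoluteGaloisGroup K →ₜ* Aˣ) :
    restrictField L (FramedRep.twist ρ χ) = FramedRep.twist (ρ.restrictField L) (χ.comp (absGaloisRestrict K L)) :=
  rfl

/-- **Restriction to a quadratic extension.**  An absolutely irreducible `ρ : Γ_K → GL_n(A)` of odd
rank `n` stays absolutely irreducible on `Γ_L` for every quadratic extension `L/K` (char. `0`):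
`Γ_L ≤ Γ_K` has index `[L:K] = 2`. [cite: Clifford1937, Thm. 1] -/
theorem IsAbsolutelyIrreducible.restrictField_of_finrank_eq_two {K : Type*} [Field K] [CharZero K]
    {A : Type v} [Field A] [TopologicalSpace A] {n : ℕ} (hn : Odd n) (L : Type*) [Field L] [Algebra K L]
    (hL : Module.finrank K L = 2) {ρ : FramedGaloisRep K A n} (h : FramedRep.IsAbsolutelyIrreducible ρ) :
    FramedRep.IsAbsolutelyIrreducible (ρ.restrictField L) := by
  haveI : FiniteDimensional K L := Module.finite_of_finrank_pos (by rw [hL]; exact two_pos)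
  have hidx := (Automorphic.isOpen_range_absGaloisRestrict_and_index K L).2
  rw [hL] at hidx
  exact FramedRep.IsAbsolutelyIrreducible.comp_of_index_two hn h (absGaloisRestrict K L) hidx

/-- **`ρ̄` absolutely irreducible ⟹ `ρ` absolutely irreducible** for `ρ : Γ_K → GL_n(ℚ̄_p)`, `n ≥ 1`
(`IsResiduallyAbsIrreducible` = Burnside form, `hasAbsolutelyIrreducibleReduction_iff_isResiduallyAbsIrreducible`).
Ref: Darmon–Diamond–Taylor, *Fermat's Last Theorem* (1995), §2.1. [cite: DarmonDiamondTaylor1995, §2.1] -/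
theorem IsResiduallyAbsIrreducible.isAbsolutelyIrreducible {p : ℕ} [Fact p.Prime] {K : Type*} [Field K]
    {n : ℕ} (hn : 0 < n) {ρ : FramedGaloisRep K (PadicAlgCl p) n} (h : ρ.IsResiduallyAbsIrreducible) :
    FramedRep.IsAbsolutelyIrreducible ρ :=
  FramedRep.HasAbsolutelyIrreducibleReduction.isAbsolutelyIrreducible hn
    ((hasAbsolutelyIrreducibleReduction_iff_isResiduallyAbsIrreducible hn ρ).2 h)

end FramedGaloisRep

end Literature.NumberTheory.GaloisRepresentations

end
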